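import Literature.MathematicalPhysics.QuantumFieldTheory.Balaban1983to89.B12LinearizAnalytic267

/-!
# `Balaban1983to89.B12Eq212BracketCoupling` — T. Bałaban, *Renormalization group approach to lattice gauge field theories. I*,
Commun. Math. Phys. **109** (1987) 249–301 [Balaban1987RG1], (2.12) p. 268 (the curly bracket
`{𝐄_k(U_k(exp i[g_kCB − hD̃(g_kCB)]V^{(k)})) − 𝐄_k(U_k(V^{(k)}))}`) with p. 267 (the substitution `Φ(B) = B − hD̃(B)`, *«it is an analytic
function of B»*) and p. 263 ll. 22–28: **the curly bracket as a function of the LAST COUPLING `g_k` — differentiable along the real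
coupling with derivative `D𝐄_k(Φ(g_kX))·DΦ(g_kX)·X` and the bound `‖D𝐄_k‖·(1 + 9C₂b‖g_kX‖(1 − 9C₂bε)⁻¹)·‖X‖`, on the schematic
substitution of record (`B12Lineariz267` ∕ `B12LinearizAnalytic267`), kernel-checked**

statement-level skeleton of published theorems with citation tags; proofs where landed; nothing here is a claim about
the Yang–Mills mass gap

PDF held: `paper:balaban1987-cmp109-rg-i-small-field` (journal page = PDF page + 248); pp. 263, 267, 268 re-read this session from
the text layer.

CITATION HEADER / WHAT IS REPRODUCED (cell `pub-ymgap`, HUMAN RULING D-0062 Track A, seat `pub-ymgap-dag-n22-b` = the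
FIRST-MISSING-ESTIMATE seat of DAG node N22 = NE9; the dag-lead's named item «(2.12)'s curly-bracket g-structure»
([DAGLEAD-G0-REBALANCE-5] (2)); a NEW LEAF over r09∕r20's `B12Lineariz267` (the substitution `Φ`, `D̃` hypothesis-style) and
`B12LinearizAnalytic267` (`hasStrictFDerivAt_phi`, `norm_hop_comp_fderiv_Dt_le`), nothing there modified).

THE PRINT.  p. 267 [PDF 19]: *«the transformation B′ = B − hD̃(B) linearizes the function Q̃(B′) … there exists exactly one solution of
this equation, and that it is an analytic function of B … Next we make the scaling transformation B = g_kB′.»*; p. 268 [PDF 20] (2.12),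
last line of the exponent: *«+ {𝐄_k(U_k(exp i[g_kCB − hD̃(g_kCB)]V^{(k)})) − 𝐄_k(U_k(V^{(k)}))}»* — the last coupling enters the curly
bracket ONLY through the argument `Φ(g_kCB)` of the old action (the tree's `B12ZeroCoupling268` reads the bracket as `E(Φ(gX)) − E(0)` with
`E` absorbing `U_k`, `exp i[·]`, `V^{(k)}`, `𝐄_k`); p. 263 ll. 22–28: the old terms are analytic on `U^c_j(X, α₀, α₁)` ((1.17)) and
*«a C^∞-function of g_{j−1}»*.  NOTHING quantitative about the `g_k`-derivative of the bracket is printed.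

WHAT THIS MODULE DOES (THEOREMS ONLY; no definition, no named fact).  On the schematic data of `B12LinearizAnalytic267` (complex Banach
spaces `𝒴`, `𝒳`; `hop` = print's `h` with `‖hX‖ ≤ b‖X‖`; `Ct` = `C̃`, quadratic-analytic; `Dt` = `D̃`, hypothesis-style on `‖B‖ < ε`;
`9C₂bε < 1`, `3ε ≤ R`), for a direction `X : 𝒴` (print: `CB`) and an old action `E : 𝒴 → ℂ` (absorbing `U_k(exp i[·]V^{(k)})`) with a
Fréchet derivative `E′` at `Φ(g₀X)`:
* §1 `norm_fderiv_phi_apply_le` — `‖DΦ(B₀)Z‖ ≤ (1 + 9C₂b‖B₀‖(1 − 9C₂bε)⁻¹)·‖Z‖` on `‖B₀‖ < ε` (`DΦ = I − h∘DD̃`,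
  `B12LinearizAnalytic267.norm_hop_comp_fderiv_Dt_le`).
* §2 **`hasDerivAt_bracket`** — the bracket `g ↦ E(Φ(g·X))` (real `g`, `‖g₀X‖ < ε`) has the derivative `E′(DΦ(g₀X)X)` at `g₀` along the
  real coupling; **`hasDerivAt_re_bracket`** — its real part (the real exponent piece `{…}` of (2.13)) has derivative `Re E′(DΦ(g₀X)X)`;
  **`abs_deriv_re_bracket_le`** — `|∂_g Re{…}| ≤ ‖E′‖·(1 + 9C₂b‖g₀X‖(1 − 9C₂bε)⁻¹)·‖X‖`, and under print's room `9C₂bε ≤ ½`: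
  `≤ 2‖E′‖‖X‖` (`abs_deriv_re_bracket_le_two`); with `X = C B` for a continuous linear `C`: `≤ ‖E′‖‖C‖(1 + ‖B‖²)`
  (`abs_deriv_re_bracket_le_quad`) — the `m₀ + ½m₂|B|²` shape that the seat's `B12Eq213CouplingDependence` v1.1 ∕
  `B12Eq213GaussianLastCoupling` take as the displayed hypothesis `hder` for the `{…}`-part of `∂_g(𝐏^{(k)} + {…})`.
HONEST READING: the chain rule on the typed substitution; `‖E′‖` is where (1.17)'s analyticity of the old action on `U^c_k` and a Cauchy
estimate enter (displayed, not supplied); `E` absorbs `U_k`, `exp i[·]`, `V^{(k)}` exactly as in `B12ZeroCoupling268` — nothing of those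
maps is modelled.

WHAT IS *NOT* HERE: the `𝐏^{(k)}`-part of the exponent (its `g_k`-structure is `B12ZeroCoupling268`'s removable-singularity analysis, per
term); higher derivatives; the norm `‖E′‖` from (1.17)∕(1.18) by a Cauchy estimate on `U^c_k(X, α₀, α₁)`.  HONEST FRAMING: count-neutral
Track-A side module; NOT a discharge of node N22; one finite T⁴ programme at fixed ε, Bałaban AS PRINTED with locators; nothing continuum ∕
ℝ⁴ ∕ OS ∕ mass-gap ∕ Clay.

v1.1 (APPEND-ONLY, seat gen 2; §§1–2 byte-identical): §3 THE BRACKET IN A COMPLEX COUPLING — p. 266's *«analytic functions of the effective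
coupling constants»* at exponent level: `z ↦ E(Φ(z·X))` is HOLOMORPHIC at every complex `z₀` with `‖z₀X‖ < ε` (`hasDerivAt_bracket_complex`,
chain rule over `ℂ`; the real-coupling §2 is its restriction), derivative `E′(DΦ(z₀X)·X)` of norm `≤ ‖E′‖(1 + 9C₂b‖z₀X‖(1 − 9C₂bε)⁻¹)‖X‖ ≤ 2‖E′‖‖X‖`
(`norm_deriv_bracket_complex_le[_two]`); on a coupling disc `|z − c| < r` (`c` real, `(|c| + r)‖X‖ < ε`) where the old action has derivatives
of norm `≤ N` at the points `Φ(zX)` and is REAL at real couplings: **`bracket_complex_letters`** — holomorphy on the disc, derivative letter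
`2N‖X‖`, imaginary-part letter `2N‖X‖·|Im z|`, real on real points — the four exponent-level letters for the `{…}`-part that
`B12Eq213AnalyticHistory.birth_letters` (module 13 §4) displays.
-/

noncomputable section

open Metric Set Filter Topology

namespace Literature.MathematicalPhysics.QuantumFieldTheory.Balaban1983to89.B12Eq212BracketCoupling

open Literature.MathematicalPhysics.QuantumFieldTheory.Balaban1983to89
open Literature.MathematicalPhysics.QuantumFieldTheory.Balaban1983to89.B13Contraction113
open Literature.MathematicalPhysics.QuantumFieldTheory.Balaban1983to89.B12LinearizAnalytic267

variable {𝒳 𝒴 : Type*} [NormedAddCommGroup 𝒳] [NormedSpace ℂ 𝒳] [CompleteSpace 𝒳]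
  [NormedAddCommGroup 𝒴] [NormedSpace ℂ 𝒴] [CompleteSpace 𝒴]
  {hop : 𝒳 →ₗ[ℂ] 𝒴} {Ct : 𝒴 → 𝒳} {C₂ R b ε : ℝ} {Dt : 𝒴 → 𝒳}

/-! ## §1. The size of `DΦ = I − h∘DD̃` -/

/-- `‖DΦ(B₀)Z‖ ≤ (1 + 9C₂b‖B₀‖(1 − 9C₂bε)⁻¹)·‖Z‖` for `‖B₀‖ < ε`, `DΦ(B₀) = I − h∘DD̃(B₀)` (the Jacobian of the substitution
of p. 267; `B12LinearizAnalytic267.norm_hop_comp_fderiv_Dt_le`). [cite: Balaban1987RG1, §2 p.267 (the substitution B′ = B − hD̃(B))] -/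
theorem norm_fderiv_phi_apply_le (hC : QuadAnalytic Ct C₂ R) (hCa : AnalyticOnNhd ℂ Ct {Y : 𝒴 | ‖Y‖ < R})
    (hC₂ : 0 ≤ C₂) (hb : 0 ≤ b) (hHop : ∀ X, ‖hop X‖ ≤ b * ‖X‖) (hq : 9 * C₂ * b * ε < 1)
    (hRC : 3 * ε ≤ R) (hDball : ∀ B : 𝒴, ‖B‖ < ε → Dt B ∈ closedBall (0:𝒳) (4 * C₂ * ε ^ 2))
    (hDfix : ∀ B : 𝒴, ‖B‖ < ε → Ct (B - hop (Dt B)) = Dt B) {B₀ : 𝒴} (hB₀ : ‖B₀‖ < ε) (Z : 𝒴) :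
    ‖(ContinuousLinearMap.id ℂ 𝒴 - hop.mkContinuous b hHop ∘L fderiv ℂ Dt B₀) Z‖
      ≤ (1 + 9 * C₂ * b * ‖B₀‖ * (1 - 9 * C₂ * b * ε)⁻¹) * ‖Z‖ := by
  have hJ := norm_hop_comp_fderiv_Dt_le hC hCa hC₂ hb hHop hq hRC hDball hDfix hB₀
  show ‖Z - (hop.mkContinuous b hHop ∘L fderiv ℂ Dt B₀) Z‖ ≤ _
  calc ‖Z - (hop.mkContinuous b hHop ∘L fderiv ℂ Dt B₀) Z‖
      ≤ ‖Z‖ + ‖(hop.mkContinuous b hHop ∘L fderiv ℂ Dt B₀) Z‖ := norm_sub_le _ _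
    _ ≤ ‖Z‖ + (9 * C₂ * b * ‖B₀‖ * (1 - 9 * C₂ * b * ε)⁻¹) * ‖Z‖ :=
        add_le_add le_rfl ((ContinuousLinearMap.le_opNorm _ _).trans (mul_le_mul_of_nonneg_right hJ (norm_nonneg _)))
    _ = (1 + 9 * C₂ * b * ‖B₀‖ * (1 - 9 * C₂ * b * ε)⁻¹) * ‖Z‖ := by ring

/-! ## §2. The curly bracket along the real coupling -/

omit [CompleteSpace 𝒳] [CompleteSpace 𝒴] in
/-- The coupling ray `g ↦ g·X` (real `g`, print's scaling `B = g_kB′` read on the direction `X = CB′`) has derivative `X`.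
[cite: Balaban1987RG1, §2 p.267 («we make the scaling transformation B = g_kB′»)] -/
theorem hasDerivAt_smul_direction (X : 𝒴) (g₀ : ℝ) : HasDerivAt (fun g : ℝ => (g : ℂ) • X) X g₀ := by
  have h : HasDerivAt (fun g : ℝ => g • X) ((1 : ℝ) • X) g₀ := (hasDerivAt_id g₀).smul_const X
  rw [one_smul] at h
  refine h.congr_of_eventuallyEq (Eventually.of_forall fun g => ?_)
  exact Complex.coe_smul g X

/-- **THE CURLY BRACKET IS DIFFERENTIABLE ALONG THE REAL COUPLING** with the chain-rule derivative: for an old action `E : 𝒴 → ℂ`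
with Fréchet derivative `E′` at `Φ(g₀X)` and `‖g₀X‖ < ε`,
`d/dg E(Φ(g·X))|_{g₀} = E′(DΦ(g₀X)·X)`, `DΦ = I − h∘DD̃`. [cite: Balaban1987RG1, (2.12) p.268 and §2 p.267] -/
theorem hasDerivAt_bracket (hC : QuadAnalytic Ct C₂ R) (hCa : AnalyticOnNhd ℂ Ct {Y : 𝒴 | ‖Y‖ < R})
    (hC₂ : 0 ≤ C₂) (hb : 0 ≤ b) (hHop : ∀ X, ‖hop X‖ ≤ b * ‖X‖) (hq : 9 * C₂ * b * ε < 1)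
    (hRC : 3 * ε ≤ R) (hDball : ∀ B : 𝒴, ‖B‖ < ε → Dt B ∈ closedBall (0:𝒳) (4 * C₂ * ε ^ 2))
    (hDfix : ∀ B : 𝒴, ‖B‖ < ε → Ct (B - hop (Dt B)) = Dt B) {E : 𝒴 → ℂ} {E' : 𝒴 →L[ℂ] ℂ}
    (X : 𝒴) {g₀ : ℝ} (hg₀ : ‖(g₀ : ℂ) • X‖ < ε)
    (hE : HasFDerivAt E E' ((g₀ : ℂ) • X - hop (Dt ((g₀ : ℂ) • X)))) :
    HasDerivAt (fun g : ℝ => E ((g : ℂ) • X - hop (Dt ((g : ℂ) • X))))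
      (E' ((ContinuousLinearMap.id ℂ 𝒴 - hop.mkContinuous b hHop ∘L fderiv ℂ Dt ((g₀ : ℂ) • X)) X)) g₀ := by
  have hΦ := (hasStrictFDerivAt_phi hC hCa hC₂ hb hHop hq hRC hDball hDfix hg₀).hasFDerivAt
  have hcurve := hasDerivAt_smul_direction X g₀
  have h1 : HasDerivAt (fun g : ℝ => (g : ℂ) • X - hop (Dt ((g : ℂ) • X)))
      ((ContinuousLinearMap.id ℂ 𝒴 - hop.mkContinuous b hHop ∘L fderiv ℂ Dt ((g₀ : ℂ) • X)) X) g₀ := by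
    have h := (hΦ.restrictScalars ℝ).comp_hasDerivAt g₀ hcurve
    simpa [Function.comp_def] using h
  have h2 := (hE.restrictScalars ℝ).comp_hasDerivAt g₀ h1
  simpa [Function.comp_def] using h2

/-- **THE REAL EXPONENT PIECE `{…}` ALONG THE REAL COUPLING**: the real part of the bracket has derivative `Re E′(DΦ(g₀X)·X)` at `g₀`
(the value `E(Φ 0) = E(0)` subtracted in print is `g`-free and drops out). [cite: Balaban1987RG1, (2.12) p.268 and §2 p.267] -/
theorem hasDerivAt_re_bracket (hC : QuadAnalytic Ct C₂ R) (hCa : AnalyticOnNhd ℂ Ct {Y : 𝒴 | ‖Y‖ < R})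
    (hC₂ : 0 ≤ C₂) (hb : 0 ≤ b) (hHop : ∀ X, ‖hop X‖ ≤ b * ‖X‖) (hq : 9 * C₂ * b * ε < 1)
    (hRC : 3 * ε ≤ R) (hDball : ∀ B : 𝒴, ‖B‖ < ε → Dt B ∈ closedBall (0:𝒳) (4 * C₂ * ε ^ 2))
    (hDfix : ∀ B : 𝒴, ‖B‖ < ε → Ct (B - hop (Dt B)) = Dt B) {E : 𝒴 → ℂ} {E' : 𝒴 →L[ℂ] ℂ}
    (X : 𝒴) {g₀ : ℝ} (hg₀ : ‖(g₀ : ℂ) • X‖ < ε)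
    (hE : HasFDerivAt E E' ((g₀ : ℂ) • X - hop (Dt ((g₀ : ℂ) • X)))) (E0 : ℂ) :
    HasDerivAt (fun g : ℝ => (E ((g : ℂ) • X - hop (Dt ((g : ℂ) • X))) - E0).re)
      ((E' ((ContinuousLinearMap.id ℂ 𝒴 - hop.mkContinuous b hHop ∘L fderiv ℂ Dt ((g₀ : ℂ) • X)) X)).re) g₀ := by
  have h := ((hasDerivAt_bracket hC hCa hC₂ hb hHop hq hRC hDball hDfix X hg₀ hE).sub_const E0)
  have h2 := Complex.reCLM.hasFDerivAt.comp_hasDerivAt g₀ h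
  simpa [Function.comp_def] using h2

/-- **THE `g_k`-DERIVATIVE OF THE BRACKET IS BOUNDED** by `‖E′‖·(1 + 9C₂b‖g₀X‖(1 − 9C₂bε)⁻¹)·‖X‖` — the size of the old action's
derivative (from (1.17)∕(1.18) by a Cauchy estimate, displayed) times the Jacobian of the substitution times the direction.
[cite: Balaban1987RG1, (2.12) p.268, §2 p.267 and p.263 (clause before (1.18))] -/
theorem abs_deriv_re_bracket_le (hC : QuadAnalytic Ct C₂ R) (hCa : AnalyticOnNhd ℂ Ct {Y : 𝒴 | ‖Y‖ < R})
    (hC₂ : 0 ≤ C₂) (hb : 0 ≤ b) (hHop : ∀ X, ‖hop X‖ ≤ b * ‖X‖) (hq : 9 * C₂ * b * ε < 1)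
    (hRC : 3 * ε ≤ R) (hDball : ∀ B : 𝒴, ‖B‖ < ε → Dt B ∈ closedBall (0:𝒳) (4 * C₂ * ε ^ 2))
    (hDfix : ∀ B : 𝒴, ‖B‖ < ε → Ct (B - hop (Dt B)) = Dt B) (E' : 𝒴 →L[ℂ] ℂ)
    (X : 𝒴) {g₀ : ℝ} (hg₀ : ‖(g₀ : ℂ) • X‖ < ε) :
    |(E' ((ContinuousLinearMap.id ℂ 𝒴 - hop.mkContinuous b hHop ∘L fderiv ℂ Dt ((g₀ : ℂ) • X)) X)).re|
      ≤ ‖E'‖ * ((1 + 9 * C₂ * b * ‖(g₀ : ℂ) • X‖ * (1 - 9 * C₂ * b * ε)⁻¹) * ‖X‖) := by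
  have hΦ := norm_fderiv_phi_apply_le hC hCa hC₂ hb hHop hq hRC hDball hDfix hg₀ X
  calc |(E' ((ContinuousLinearMap.id ℂ 𝒴 - hop.mkContinuous b hHop ∘L fderiv ℂ Dt ((g₀ : ℂ) • X)) X)).re|
      ≤ ‖E' ((ContinuousLinearMap.id ℂ 𝒴 - hop.mkContinuous b hHop ∘L fderiv ℂ Dt ((g₀ : ℂ) • X)) X)‖ :=
        Complex.abs_re_le_norm _
    _ ≤ ‖E'‖ * ‖(ContinuousLinearMap.id ℂ 𝒴 - hop.mkContinuous b hHop ∘L fderiv ℂ Dt ((g₀ : ℂ) • X)) X‖ :=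
        E'.le_opNorm _
    _ ≤ ‖E'‖ * ((1 + 9 * C₂ * b * ‖(g₀ : ℂ) • X‖ * (1 - 9 * C₂ * b * ε)⁻¹) * ‖X‖) :=
        mul_le_mul_of_nonneg_left hΦ (norm_nonneg _)

/-- Under print's room `9C₂bε ≤ ½` (the contraction constant of [15] Sect. C, `B12Lineariz267`), the Jacobian factor is `≤ 2`:
`|∂_g Re{…}(g₀)| ≤ 2‖E′‖‖X‖`. [cite: Balaban1987RG1, (2.12) p.268 and §2 p.267] -/
theorem abs_deriv_re_bracket_le_two (hC : QuadAnalytic Ct C₂ R) (hCa : AnalyticOnNhd ℂ Ct {Y : 𝒴 | ‖Y‖ < R})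
    (hC₂ : 0 ≤ C₂) (hb : 0 ≤ b) (hHop : ∀ X, ‖hop X‖ ≤ b * ‖X‖) (hq2 : 9 * C₂ * b * ε ≤ 1 / 2)
    (hRC : 3 * ε ≤ R) (hDball : ∀ B : 𝒴, ‖B‖ < ε → Dt B ∈ closedBall (0:𝒳) (4 * C₂ * ε ^ 2))
    (hDfix : ∀ B : 𝒴, ‖B‖ < ε → Ct (B - hop (Dt B)) = Dt B) (E' : 𝒴 →L[ℂ] ℂ)
    (X : 𝒴) {g₀ : ℝ} (hg₀ : ‖(g₀ : ℂ) • X‖ < ε) :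
    |(E' ((ContinuousLinearMap.id ℂ 𝒴 - hop.mkContinuous b hHop ∘L fderiv ℂ Dt ((g₀ : ℂ) • X)) X)).re|
      ≤ 2 * ‖E'‖ * ‖X‖ := by
  have hq : 9 * C₂ * b * ε < 1 := by linarith
  have h := abs_deriv_re_bracket_le hC hCa hC₂ hb hHop hq hRC hDball hDfix E' X hg₀
  have hε : 0 ≤ ε := le_of_lt ((norm_nonneg _).trans_lt hg₀)
  have hcoef : 9 * C₂ * b * ‖(g₀ : ℂ) • X‖ * (1 - 9 * C₂ * b * ε)⁻¹ ≤ 1 := by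
    have h1 : 9 * C₂ * b * ‖(g₀ : ℂ) • X‖ ≤ 9 * C₂ * b * ε :=
      mul_le_mul_of_nonneg_left hg₀.le (by positivity)
    have h2 : (1 - 9 * C₂ * b * ε)⁻¹ ≤ 2 := by
      rw [inv_le_comm₀ (by linarith) (by norm_num)]
      linarith
    calc 9 * C₂ * b * ‖(g₀ : ℂ) • X‖ * (1 - 9 * C₂ * b * ε)⁻¹ ≤ (9 * C₂ * b * ε) * 2 :=
          mul_le_mul h1 h2 (inv_nonneg.2 (by linarith)) (by positivity)
      _ ≤ 1 := by linarith
  calc |(E' ((ContinuousLinearMap.id ℂ 𝒴 - hop.mkContinuous b hHop ∘L fderiv ℂ Dt ((g₀ : ℂ) • X)) X)).re|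
      ≤ ‖E'‖ * ((1 + 9 * C₂ * b * ‖(g₀ : ℂ) • X‖ * (1 - 9 * C₂ * b * ε)⁻¹) * ‖X‖) := h
    _ ≤ ‖E'‖ * (2 * ‖X‖) := by
        refine mul_le_mul_of_nonneg_left ?_ (norm_nonneg _)
        exact mul_le_mul_of_nonneg_right (by linarith) (norm_nonneg _)
    _ = 2 * ‖E'‖ * ‖X‖ := by ring

/-- With the direction `X = C B` for a continuous linear `C` (print's elimination operator, `B′ = CB`), the bound takes the
`m₀ + ½m₂|B|²` SHAPE consumed by the seat's last-coupling theorems (`B12Eq213GaussianLastCoupling`, hypothesis `hder` for the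
`{…}`-part): `|∂_g Re{…}(g₀)| ≤ ‖E′‖‖C‖·(1 + ‖B‖²)` (`2‖B‖ ≤ 1 + ‖B‖²`). [cite: Balaban1987RG1, (2.12) p.268 and §2 p.267] -/
theorem abs_deriv_re_bracket_le_quad (hC : QuadAnalytic Ct C₂ R) (hCa : AnalyticOnNhd ℂ Ct {Y : 𝒴 | ‖Y‖ < R})
    (hC₂ : 0 ≤ C₂) (hb : 0 ≤ b) (hHop : ∀ X, ‖hop X‖ ≤ b * ‖X‖) (hq2 : 9 * C₂ * b * ε ≤ 1 / 2)
    (hRC : 3 * ε ≤ R) (hDball : ∀ B : 𝒴, ‖B‖ < ε → Dt B ∈ closedBall (0:𝒳) (4 * C₂ * ε ^ 2))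
    (hDfix : ∀ B : 𝒴, ‖B‖ < ε → Ct (B - hop (Dt B)) = Dt B) (E' : 𝒴 →L[ℂ] ℂ)
    {𝒲 : Type*} [NormedAddCommGroup 𝒲] [NormedSpace ℂ 𝒲] (Cop : 𝒲 →L[ℂ] 𝒴) (B : 𝒲) {g₀ : ℝ}
    (hg₀ : ‖(g₀ : ℂ) • Cop B‖ < ε) :
    |(E' ((ContinuousLinearMap.id ℂ 𝒴 - hop.mkContinuous b hHop ∘L fderiv ℂ Dt ((g₀ : ℂ) • Cop B)) (Cop B))).re|
      ≤ ‖E'‖ * ‖Cop‖ * (1 + ‖B‖ ^ 2) := by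
  have h := abs_deriv_re_bracket_le_two hC hCa hC₂ hb hHop hq2 hRC hDball hDfix E' (Cop B) hg₀
  have hCB : ‖Cop B‖ ≤ ‖Cop‖ * ‖B‖ := Cop.le_opNorm B
  have hsq : 2 * ‖B‖ ≤ 1 + ‖B‖ ^ 2 := by nlinarith [sq_nonneg (‖B‖ - 1)]
  calc |(E' ((ContinuousLinearMap.id ℂ 𝒴 - hop.mkContinuous b hHop ∘L fderiv ℂ Dt ((g₀ : ℂ) • Cop B)) (Cop B))).re|
      ≤ 2 * ‖E'‖ * ‖Cop B‖ := h
    _ ≤ 2 * ‖E'‖ * (‖Cop‖ * ‖B‖) := mul_le_mul_of_nonneg_left hCB (by positivity)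
    _ = ‖E'‖ * ‖Cop‖ * (2 * ‖B‖) := by ring
    _ ≤ ‖E'‖ * ‖Cop‖ * (1 + ‖B‖ ^ 2) := mul_le_mul_of_nonneg_left hsq (by positivity)

/-! ## §3 (v1.1). The bracket in a COMPLEX coupling: the exponent-level analytic letters -/

omit [CompleteSpace 𝒳] [CompleteSpace 𝒴] in
/-- The COMPLEX coupling ray `z ↦ z·X` has derivative `X` (p. 266's alternative: the coupling as a complex parameter of the scaling
`B = g_kB′`). [cite: Balaban1987RG1, §2 p.267 («we make the scaling transformation B = g_kB′») and p.266 (after (2.9))] -/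
theorem hasDerivAt_smul_direction_complex (X : 𝒴) (z₀ : ℂ) : HasDerivAt (fun z : ℂ => z • X) X z₀ := by
  have h : HasDerivAt (fun z : ℂ => z • X) ((1 : ℂ) • X) z₀ := (hasDerivAt_id z₀).smul_const X
  rwa [one_smul] at h

/-- **THE CURLY BRACKET IS HOLOMORPHIC IN A COMPLEX COUPLING** with the chain-rule derivative: for an old action `E : 𝒴 → ℂ` with Fréchet
derivative `E′` at `Φ(z₀X)` and `‖z₀X‖ < ε` (`z₀ ∈ ℂ`), `d/dz E(Φ(z·X))|_{z₀} = E′(DΦ(z₀X)·X)` — §2's `hasDerivAt_bracket` is the restriction to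
real `z₀`. [cite: Balaban1987RG1, (2.12) p.268, §2 p.267 and p.266 (after (2.9))] -/
theorem hasDerivAt_bracket_complex (hC : QuadAnalytic Ct C₂ R) (hCa : AnalyticOnNhd ℂ Ct {Y : 𝒴 | ‖Y‖ < R})
    (hC₂ : 0 ≤ C₂) (hb : 0 ≤ b) (hHop : ∀ X, ‖hop X‖ ≤ b * ‖X‖) (hq : 9 * C₂ * b * ε < 1)
    (hRC : 3 * ε ≤ R) (hDball : ∀ B : 𝒴, ‖B‖ < ε → Dt B ∈ closedBall (0:𝒳) (4 * C₂ * ε ^ 2))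
    (hDfix : ∀ B : 𝒴, ‖B‖ < ε → Ct (B - hop (Dt B)) = Dt B) {E : 𝒴 → ℂ} {E' : 𝒴 →L[ℂ] ℂ}
    (X : 𝒴) {z₀ : ℂ} (hz₀ : ‖z₀ • X‖ < ε)
    (hE : HasFDerivAt E E' (z₀ • X - hop (Dt (z₀ • X)))) :
    HasDerivAt (fun z : ℂ => E (z • X - hop (Dt (z • X))))
      (E' ((ContinuousLinearMap.id ℂ 𝒴 - hop.mkContinuous b hHop ∘L fderiv ℂ Dt (z₀ • X)) X)) z₀ := by
  have hΦ := (hasStrictFDerivAt_phi hC hCa hC₂ hb hHop hq hRC hDball hDfix hz₀).hasFDerivAt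
  have hcurve := hasDerivAt_smul_direction_complex X z₀
  have h1 : HasDerivAt (fun z : ℂ => z • X - hop (Dt (z • X)))
      ((ContinuousLinearMap.id ℂ 𝒴 - hop.mkContinuous b hHop ∘L fderiv ℂ Dt (z₀ • X)) X) z₀ := by
    have h := hΦ.comp_hasDerivAt z₀ hcurve
    simpa [Function.comp_def] using h
  have h2 := hE.comp_hasDerivAt z₀ h1
  simpa [Function.comp_def] using h2

/-- **THE COMPLEX-COUPLING DERIVATIVE OF THE BRACKET IS BOUNDED** by `‖E′‖·(1 + 9C₂b‖z₀X‖(1 − 9C₂bε)⁻¹)·‖X‖`.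
[cite: Balaban1987RG1, (2.12) p.268, §2 p.267 and p.263 (clause before (1.18))] -/
theorem norm_deriv_bracket_complex_le (hC : QuadAnalytic Ct C₂ R) (hCa : AnalyticOnNhd ℂ Ct {Y : 𝒴 | ‖Y‖ < R})
    (hC₂ : 0 ≤ C₂) (hb : 0 ≤ b) (hHop : ∀ X, ‖hop X‖ ≤ b * ‖X‖) (hq : 9 * C₂ * b * ε < 1)
    (hRC : 3 * ε ≤ R) (hDball : ∀ B : 𝒴, ‖B‖ < ε → Dt B ∈ closedBall (0:𝒳) (4 * C₂ * ε ^ 2))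
    (hDfix : ∀ B : 𝒴, ‖B‖ < ε → Ct (B - hop (Dt B)) = Dt B) (E' : 𝒴 →L[ℂ] ℂ)
    (X : 𝒴) {z₀ : ℂ} (hz₀ : ‖z₀ • X‖ < ε) :
    ‖E' ((ContinuousLinearMap.id ℂ 𝒴 - hop.mkContinuous b hHop ∘L fderiv ℂ Dt (z₀ • X)) X)‖
      ≤ ‖E'‖ * ((1 + 9 * C₂ * b * ‖z₀ • X‖ * (1 - 9 * C₂ * b * ε)⁻¹) * ‖X‖) :=
  (E'.le_opNorm _).trans
    (mul_le_mul_of_nonneg_left (norm_fderiv_phi_apply_le hC hCa hC₂ hb hHop hq hRC hDball hDfix hz₀ X) (norm_nonneg _))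

/-- Under print's room `9C₂bε ≤ ½`: `‖∂_z E(Φ(z·X))|_{z₀}‖ ≤ 2‖E′‖‖X‖`. [cite: Balaban1987RG1, (2.12) p.268 and §2 p.267] -/
theorem norm_deriv_bracket_complex_le_two (hC : QuadAnalytic Ct C₂ R) (hCa : AnalyticOnNhd ℂ Ct {Y : 𝒴 | ‖Y‖ < R})
    (hC₂ : 0 ≤ C₂) (hb : 0 ≤ b) (hHop : ∀ X, ‖hop X‖ ≤ b * ‖X‖) (hq2 : 9 * C₂ * b * ε ≤ 1 / 2)
    (hRC : 3 * ε ≤ R) (hDball : ∀ B : 𝒴, ‖B‖ < ε → Dt B ∈ closedBall (0:𝒳) (4 * C₂ * ε ^ 2))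
    (hDfix : ∀ B : 𝒴, ‖B‖ < ε → Ct (B - hop (Dt B)) = Dt B) (E' : 𝒴 →L[ℂ] ℂ)
    (X : 𝒴) {z₀ : ℂ} (hz₀ : ‖z₀ • X‖ < ε) :
    ‖E' ((ContinuousLinearMap.id ℂ 𝒴 - hop.mkContinuous b hHop ∘L fderiv ℂ Dt (z₀ • X)) X)‖ ≤ 2 * ‖E'‖ * ‖X‖ := by
  have hq : 9 * C₂ * b * ε < 1 := by linarith
  have h := norm_deriv_bracket_complex_le hC hCa hC₂ hb hHop hq hRC hDball hDfix E' X hz₀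
  have hε : 0 ≤ ε := le_of_lt ((norm_nonneg _).trans_lt hz₀)
  have hcoef : 9 * C₂ * b * ‖z₀ • X‖ * (1 - 9 * C₂ * b * ε)⁻¹ ≤ 1 := by
    have h1 : 9 * C₂ * b * ‖z₀ • X‖ ≤ 9 * C₂ * b * ε := mul_le_mul_of_nonneg_left hz₀.le (by positivity)
    have h2 : (1 - 9 * C₂ * b * ε)⁻¹ ≤ 2 := by
      rw [inv_le_comm₀ (by linarith) (by norm_num)]
      linarith
    calc 9 * C₂ * b * ‖z₀ • X‖ * (1 - 9 * C₂ * b * ε)⁻¹ ≤ (9 * C₂ * b * ε) * 2 :=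
          mul_le_mul h1 h2 (inv_nonneg.2 (by linarith)) (by positivity)
      _ ≤ 1 := by linarith
  calc ‖E' ((ContinuousLinearMap.id ℂ 𝒴 - hop.mkContinuous b hHop ∘L fderiv ℂ Dt (z₀ • X)) X)‖
      ≤ ‖E'‖ * ((1 + 9 * C₂ * b * ‖z₀ • X‖ * (1 - 9 * C₂ * b * ε)⁻¹) * ‖X‖) := h
    _ ≤ ‖E'‖ * (2 * ‖X‖) := by
        refine mul_le_mul_of_nonneg_left ?_ (norm_nonneg _)
        exact mul_le_mul_of_nonneg_right (by linarith) (norm_nonneg _)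
    _ = 2 * ‖E'‖ * ‖X‖ := by ring

omit [CompleteSpace 𝒳] [CompleteSpace 𝒴] in
/-- A coupling disc `|z − c| < r` about a real centre with `(|c| + r)‖X‖ < ε` keeps the scaled direction small: `‖zX‖ < ε`; it is convex and
closed under `z ↦ Re z`. [folklore] -/
private theorem smul_mem_small {X : 𝒴} {c r ε' : ℝ} (hcr : (|c| + r) * ‖X‖ < ε') {z : ℂ} (hz : z ∈ ball (c : ℂ) r) :
    ‖z • X‖ < ε' ∧ ((z.re : ℝ) : ℂ) ∈ ball (c : ℂ) r := by
  rw [mem_ball, dist_eq_norm] at hz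
  refine ⟨?_, ?_⟩
  · rw [norm_smul]
    have hz' : ‖z‖ ≤ |c| + r := by
      calc ‖z‖ ≤ ‖z - (c : ℂ)‖ + ‖(c : ℂ)‖ := norm_le_norm_sub_add z (c : ℂ)
        _ ≤ r + |c| := by rw [Complex.norm_real, Real.norm_eq_abs]; linarith
        _ = |c| + r := add_comm _ _
    calc ‖z‖ * ‖X‖ ≤ (|c| + r) * ‖X‖ := mul_le_mul_of_nonneg_right hz' (norm_nonneg _)
      _ < ε' := hcr
  · rw [mem_ball, dist_eq_norm, ← Complex.ofReal_sub, Complex.norm_real, Real.norm_eq_abs]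
    calc |z.re - c| = |(z - (c : ℂ)).re| := by simp
      _ ≤ ‖z - (c : ℂ)‖ := Complex.abs_re_le_norm _
      _ < r := hz

/-- **THE EXPONENT-LEVEL ANALYTIC LETTERS OF THE BRACKET ON A COUPLING DISC.**  On the disc `O = {|z − c| < r}` (`c` real, `r > 0`,
`(|c| + r)‖X‖ < ε`, print's room `9C₂bε ≤ ½`), let the old action `E` have a Fréchet derivative `E′_z` at `Φ(zX)` for every `z ∈ O` with
`‖E′_z‖ ≤ N` ((1.17)∕(1.18) on the complex small-field domain and a Cauchy estimate — DISPLAYED), and be REAL at real couplings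
(`Im E(Φ(tX)) = 0` for real `t ∈ O` — the physical bracket is real).  Then `z ↦ E(Φ(zX))` is holomorphic on `O`; its derivative letter is
`2N‖X‖`; **its imaginary-part letter is `2N‖X‖·|Im z|`** (vertical mean value from the real axis); and it is real on real points — the four
exponent-level letters (for the `{…}`-part of (2.12)) displayed by `B12Eq213AnalyticHistory.birth_letters`.
[cite: Balaban1987RG1, p.266 (after (2.9)), (2.12) p.268, §2 p.267 and p.263 (clause before (1.18))] -/
theorem bracket_complex_letters (hC : QuadAnalytic Ct C₂ R) (hCa : AnalyticOnNhd ℂ Ct {Y : 𝒴 | ‖Y‖ < R})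
    (hC₂ : 0 ≤ C₂) (hb : 0 ≤ b) (hHop : ∀ X, ‖hop X‖ ≤ b * ‖X‖) (hq2 : 9 * C₂ * b * ε ≤ 1 / 2)
    (hRC : 3 * ε ≤ R) (hDball : ∀ B : 𝒴, ‖B‖ < ε → Dt B ∈ closedBall (0:𝒳) (4 * C₂ * ε ^ 2))
    (hDfix : ∀ B : 𝒴, ‖B‖ < ε → Ct (B - hop (Dt B)) = Dt B) {E : 𝒴 → ℂ} (E' : ℂ → 𝒴 →L[ℂ] ℂ) {N : ℝ}
    (X : 𝒴) {c r : ℝ} (hcr : (|c| + r) * ‖X‖ < ε)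
    (hE : ∀ z ∈ ball (c : ℂ) r, HasFDerivAt E (E' z) (z • X - hop (Dt (z • X))))
    (hN : ∀ z ∈ ball (c : ℂ) r, ‖E' z‖ ≤ N)
    (hreal : ∀ t : ℝ, (t : ℂ) ∈ ball (c : ℂ) r → (E ((t : ℂ) • X - hop (Dt ((t : ℂ) • X)))).im = 0) :
    DifferentiableOn ℂ (fun z : ℂ => E (z • X - hop (Dt (z • X)))) (ball (c : ℂ) r) ∧
    (∀ z ∈ ball (c : ℂ) r, ‖deriv (fun z : ℂ => E (z • X - hop (Dt (z • X)))) z‖ ≤ 2 * N * ‖X‖) ∧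
    (∀ z ∈ ball (c : ℂ) r, |(E (z • X - hop (Dt (z • X)))).im| ≤ 2 * N * ‖X‖ * |z.im|) ∧
    (∀ t : ℝ, (t : ℂ) ∈ ball (c : ℂ) r →
      E ((t : ℂ) • X - hop (Dt ((t : ℂ) • X))) = (((E ((t : ℂ) • X - hop (Dt ((t : ℂ) • X)))).re : ℝ) : ℂ)) := by
  have hder : ∀ z ∈ ball (c : ℂ) r, HasDerivAt (fun z : ℂ => E (z • X - hop (Dt (z • X))))
      (E' z ((ContinuousLinearMap.id ℂ 𝒴 - hop.mkContinuous b hHop ∘L fderiv ℂ Dt (z • X)) X)) z := fun z hz =>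
    hasDerivAt_bracket_complex hC hCa hC₂ hb hHop (by linarith) hRC hDball hDfix X (smul_mem_small hcr hz).1 (hE z hz)
  have hbound : ∀ z ∈ ball (c : ℂ) r, ‖deriv (fun z : ℂ => E (z • X - hop (Dt (z • X)))) z‖ ≤ 2 * N * ‖X‖ := by
    intro z hz
    rw [(hder z hz).deriv]
    calc ‖E' z ((ContinuousLinearMap.id ℂ 𝒴 - hop.mkContinuous b hHop ∘L fderiv ℂ Dt (z • X)) X)‖
        ≤ 2 * ‖E' z‖ * ‖X‖ := norm_deriv_bracket_complex_le_two hC hCa hC₂ hb hHop hq2 hRC hDball hDfix (E' z) X (smul_mem_small hcr hz).1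
      _ ≤ 2 * N * ‖X‖ := by
          have := hN z hz
          have hX := norm_nonneg X
          nlinarith
  have hdiff : DifferentiableOn ℂ (fun z : ℂ => E (z • X - hop (Dt (z • X)))) (ball (c : ℂ) r) :=
    fun z hz => (hder z hz).differentiableAt.differentiableWithinAt
  refine ⟨hdiff, hbound, fun z hz => ?_, fun t ht => ?_⟩
  · -- vertical mean value from the real point `Re z`
    have hzre := (smul_mem_small hcr hz).2
    have hmv := (convex_ball (c : ℂ) r).norm_image_sub_le_of_norm_deriv_le (f := fun z : ℂ => E (z • X - hop (Dt (z • X))))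
      (fun w hw => (hder w hw).differentiableAt) hbound hzre hz
    have hgeom : ‖z - (z.re : ℂ)‖ = |z.im| := by
      have h : z - (z.re : ℂ) = (z.im : ℂ) * Complex.I := by apply Complex.ext <;> simp
      rw [h, norm_mul, Complex.norm_I, mul_one, Complex.norm_real, Real.norm_eq_abs]
    rw [hgeom] at hmv
    have him : (E (z • X - hop (Dt (z • X))) - E ((z.re : ℂ) • X - hop (Dt ((z.re : ℂ) • X)))).im
        = (E (z • X - hop (Dt (z • X)))).im := by rw [Complex.sub_im, hreal z.re hzre, sub_zero]
    calc |(E (z • X - hop (Dt (z • X)))).im|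
        = |(E (z • X - hop (Dt (z • X))) - E ((z.re : ℂ) • X - hop (Dt ((z.re : ℂ) • X)))).im| := by rw [him]
      _ ≤ ‖E (z • X - hop (Dt (z • X))) - E ((z.re : ℂ) • X - hop (Dt ((z.re : ℂ) • X)))‖ := Complex.abs_im_le_norm _
      _ ≤ 2 * N * ‖X‖ * |z.im| := hmv
  · exact Complex.ext (by simp) (by simpa using hreal t ht)

end Literature.MathematicalPhysics.QuantumFieldTheory.Balaban1983to89.B12Eq212BracketCoupling
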